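import Summits.CriticalPhenomena.Ising3DConformalLimit.Theses.LeeYangGap
import Summits.CriticalPhenomena.Ising3DConformalLimit.Theorems.LeeYangGapNearCriticalLeeYangGapCorrLengthUnbounded
import Summits.CriticalPhenomena.Ising3DConformalLimit.Theorems.LeeYangGapNearCriticalLeeYangGapCriticalWindowVarianceReductions
import Literature.Probability.LatticeModels.CriticalTwoPointLower
import Literature.Probability.LatticeModels.LeeYangFirstZeroLimit
import Summits.CriticalPhenomena.Ising3DConformalLimit.Theorems.LeeYangGapNearCriticalLeeYangGapFirstZeroAttained
import Summits.CriticalPhenomena.Ising3DConformalLimit.Theorems.LeeYangGapNearCriticalLeeYangGapCubeZeroToFreeBox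
import Summits.CriticalPhenomena.Ising3DConformalLimit.Theorems.LeeYangGapNearCriticalLeeYangGapBlockZeroOfFreeBoxZeros
import Summits.CriticalPhenomena.Ising3DConformalLimit.Theorems.LeeYangGapNearCriticalLeeYangGapEdgeAnalyticity
import Summits.CriticalPhenomena.Ising3DConformalLimit.Theorems.LeeYangGapNearCriticalLeeYangGapSusceptibilityDoubling
import Summits.CriticalPhenomena.Ising3DConformalLimit.Theorems.LeeYangGapNearCriticalLeeYangGapCubeGapFunnel
import Summits.CriticalPhenomena.Ising3DConformalLimit.Theorems.LeeYangGapNearCriticalLeeYangGapCriticalCubeGap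
import Summits.CriticalPhenomena.Ising3DConformalLimit.Theorems.LeeYangGapNearCriticalLeeYangGapFirstZeroRateAnatomy
import Summits.CriticalPhenomena.Ising3DConformalLimit.Theorems.LeeYangGapNearCriticalLeeYangGapFirstZeroRateCharacterisation
import Summits.CriticalPhenomena.Ising3DConformalLimit.Theorems.LeeYangGapNearCriticalLeeYangGapCubeEdgeImpliesEdge
import Summits.CriticalPhenomena.Ising3DConformalLimit.Theorems.LeeYangGapNearCriticalLeeYangGapEdgeCubeDictionary

/-!
# Skeleton (line `registered`, v13 = v10 + the c6 anatomy, lead c6) for crux `NearCriticalLeeYangGap` — item stmt-CriticalPhenomena-4945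

v13 (lead c6) = v12 + p166742 `LeeYangGapNearCriticalLeeYangGapEdgeCubeDictionary.lean`: registered anatomy stub
`stub_edgeIffInfCubeZeroScaling` : EDGE ⟺ (II_∞) `∃ C β₀ ∀β∈[β₀,β_c), (⨅ n, α₁(Λ_n,β))²·χ(β)·ξ(β)³ ≤ C` (the
route's crux EDGE, item 4946, as an inequality on classical cube partition-function zeros), and
`cubeReverseEdge_iff_reverseEdge` : (I) ⟺ reverse EDGE in the route's vocabulary. COMPLETE DICTIONARY of the
line's Lee–Yang inputs (all tree theorems): EDGE ⟺ (II_∞); reverse-EDGE ⟺ (I); S1r ∧ EDGE ⟺ (I) ∧ (II);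
EDGE ⊢ S1r ⟺ (I) ∧ (II); S1r ⟺ its one-cube instance. Open stubs UNCHANGED: S1r, S2χ₁.

v12 (lead c6) = v11 + p166341 `LeeYangGapNearCriticalLeeYangGapCubeEdgeImpliesEdge.lean`: the registered
anatomy stub `stub_edgeOfCubeEdgeScaling` : (II) → EDGE (route item 4946, by name) through the UNCONDITIONAL
`mul_le_firstZero_of_magnetization_strip` (`d ≥ 2`, `0 < β < β_c`: a holomorphic extension of `m(β,·)` to
`{|Im h| < θ}` forces `βθ ≤ α₁(B_n,β)` for every `n` — Jiang–Newman Cor. 1's direction with no analyticity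
input), and `firstZeroRate_and_edge_iff` : **S1r ∧ EDGE ⟺ (I) ∧ (II)** outright (wired below as
`firstZeroRate_and_edge_iff_twoSidedCubeEdge`; (I), (II) are NOT registered as stubs — they are open
anatomy statements, not targets): the line's two Lee–Yang inputs are, jointly, exactly
two-sided edge hyperscaling `c ≤ α₁(Λ_L,β)²χ(β)ξ(β)³ ≤ C` on all free cubes from `K₀` correlation lengths on.

v11 (lead c6, 2026-08-17) — open stubs UNCHANGED (S1r `stub_firstZeroRate`, S2χ₁
`stub_susceptibilityComparabilityOneScale`; composition as in v9/v10). Landed `--supports 4945` this session: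
* p165482 `LeeYangGapNearCriticalLeeYangGapFirstZeroRateCharacterisation.lean` — the registered anatomy stub
  `stub_firstZeroRateOfCubeEdgeScaling` : (I) → (II) → S1r, where (I) = reverse edge hyperscaling on cubes
  (`c ≤ α₁(Λ_n,β)²χξ³ ∀n`, the conclusion of c5's `stub_reverseEdgeOfFirstZeroRate`) and (II) = edge
  hyperscaling on cubes beyond `K₀ξ` (`α₁(Λ_L,β)²χξ³ ≤ C ∀L ≥ K₀ξ`, the conclusion of c5's
  `cubeZero_sq_mul_le_of_edge_of_firstZeroRate`); hence `firstZeroRate_iff_of_edge` : **EDGE ⊢ S1r ⟺ (I) ∧ (II)**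
  — the held stub IS two-sided edge hyperscaling `α₁(Λ_L,β)² ≍ (χξ³)⁻¹` on every free cube from `K₀`
  correlation lengths on (wired below as `firstZeroRate_iff_twoSidedCubeEdge`); and `firstZeroRate_iff_diagonal` :
  S1r ⟺ its single-cube instance `L = ⌈K₀ξ(β)⌉₊` (CJN antitonicity in the volume).
* numerics (the route's CHEAPEST FALSIFIER, first run by any seat): kit job j026695 (`--workitem 4945`; refinement j027336),
  tables in `Lines/registered-numerics-c6.md`: at β_c the cube-block first zero is FLAT, t₁(L) = θ₁Σ_L^{1/2} = 1.99 ± 0.02,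
  g_L = 0.85 ± 0.02 for sides 5…19 (GAP_c numerically true, C ≈ 4); (CG_c) constant ≈ 22–25; free-cube zeros below β_c collapse
  as α₁ξ^{y_h} = F(n/ξ) within ±15 % for n ≤ 2ξ. No registered statement is contradicted.
VERDICT (lead c6) = c5's, now an equivalence theorem: line `registered` is closed modulo {S1r, S2χ₁} with S1r =
two-sided cube edge hyperscaling (given EDGE) and S2χ₁ = inner criticality (item 6032); its output (CG_c) ≥ crux.

v10 (lead c5, 2026-08-17) — header kept below.

# (v10 header) Skeleton (line `registered`, v10 = v9 + the c5 findings, lead c5)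

v10 (lead c5, 2026-08-17) — stubs UNCHANGED (S1r, S2χ₁; composition as in v9); two more files landed
`--supports 4945` and the line declared DEAD (`Lines/registered.dead.md`):
* p161870 `LeeYangGapNearCriticalLeeYangGapCriticalCubeGap.lean` — the funnel is a statement AT β_c:
  `firstZero_box_antitone_beta` (CJN 2023 Thm 2 for the free cube's classical zeros, via the PROVED
  item 4947), `cubeGap_iff_criticalCubeGap` : (CG) ↔ (CG_c) := `∃ C, ∃ᶠ L, α₁(Λ_L,β_c)²·Σ_L ≤ C`,
  `nearCriticalLeeYangGap_iff_criticalBlockGap` : GAP ↔ GAP_c (its β = β_c instance, PROVED items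
  4947+4948), `stub_gapOfCriticalCubeGap` : (CG_c) → GAP (registered glue);
* p162060 `LeeYangGapNearCriticalLeeYangGapFirstZeroRateAnatomy.lean` — ANATOMY of S1r:
  `stub_reverseEdgeOfFirstZeroRate` : S1r ⟹ `c ≤ α₁(Λ_n,β)²·χ(β)·ξ(β)³` for ALL n, β ∈ [β₁,β_c)
  (reverse edge hyperscaling, θ_e²χξ³ ≥ c in the JN limit — the REVERSE of crux EDGE);
  `cubeZero_frozen_of_edge_of_firstZeroRate` : EDGE+S1r ⟹ `c ≤ α₁(Λ_L,β)²χξ³ ≤ C` for L ≥ K₀ξ;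
  `cubeZero_sq_mul_variance_le_of_edge_of_firstZeroRate` : EDGE+S1r ⟹ `α₁(Λ_L,β)²⟨M_L²⟩^free ≤ C'`
  on ξ-cubes, i.e. (Newman 12/t₁⁴ ≤ |κ₄|/Var²) ξ-SCALE CUBE NON-GAUSSIANITY uniformly as β↑β_c.
VERDICT (lead c5): the subcritical detour EDGE + S1r + S2χ₁ needs two-sided edge hyperscaling, ξ-scale
finite-size non-Gaussianity and (S2χ₁ = inner criticality, item 6032) the Fisher amplitude relation —
three open d = 3 amplitude statements — to output ONE critical statement (CG_c) that is itself ≥ the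
crux (GAP ⟺ GAP_c ⟺ critical block Binder cumulant ↛ 0, all in tree). The inputs dominate the output:
line `registered` no longer reduces the crux ⇒ line-dead; no stub is false. The honest leaf is GAP
itself (= 3D Ising critical non-Gaussianity in block form, open); if a child is wanted, (CG_c) with
assembly `stub_gapOfCriticalCubeGap`.

v7–v9 (lead c4, 2026-08-17). The sorry-free COMPOSITION of v6 (`NearCriticalLeeYangGap_of`, lead c3)
was registered as the glue stub S3 `stub_gapOfEdgeRateOneScale` — `EDGE → S1r → S2χ₁ → GAP`, the two
open cores written out verbatim — and LANDED under `Theorems/` (p158764,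
`LeeYangGapNearCriticalLeeYangGapReduction.lean`). v9 makes the line's FUNNEL explicit and landed
(p159412, `LeeYangGapNearCriticalLeeYangGapCubeGapFunnel.lean`): the three open statements EDGE, S1r,
S2χ₁ are used ONLY to produce the **cube gap**

  (CG)  `∃ C, ∃ᶠ L, ∃ β ∈ [0, β_c(3)], α₁(Λ_L,β)² · Σ_L ≤ C`

(first Lee–Yang zero of the FREE CUBE `Λ_L` at some `β ≤ β_c` against the critical block variance;
Lean: the hypothesis of `LeeYangGapNearCriticalLeeYangGap.stub_gapOfCubeGap`, verbatim), and (CG) ALONE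
implies the crux by landed theorems (`stub_gapOfCubeGap`: S1a + S1v + S1t + `Σ_L > 0`). The composing
theorem below is `stub_gapOfCubeGap (stub_cubeGapOfEdgeRateOneScale hE hR hχ₁)`. Open cores unchanged
and the file's only `sorry`s: S1r `stub_firstZeroRate`, S2χ₁ `stub_susceptibilityComparabilityOneScale`
(both crux-sized d = 3 statements, see the v6 notes kept below); EDGE = route item 4946, by name.
PLANNER NOTE (lead c4): if the two stubs are promoted, the leaner promotion is the single child (CG)
(exact signature in the Funnel file; at `β = β_c` it is the lower half of Itzykson–Pearson–Zuber
finite-size scaling of the critical cube's first partition-function zero, `h₁(L) ≍ L^{-y_h}`); (CG) is a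
`d = 3` non-triviality statement like GAP itself (false for `d ≥ 5`), so no further line lead on
`registered` can move it with in-tree tools.

Route `LeeYangGap` (route-CriticalPhenomena-LeeYangGap), crux rank 2 (GAP), concluded BY NAME:
`Summit.CriticalPhenomena.Ising3DConformalLimit.Theses.LeeYangGap.NearCriticalLeeYangGap` —
there is `C` such that for infinitely many block sizes `L` some `β ∈ [0, β_c(3)]` and some real zero
`θ > 0` of the block characteristic function `θ ↦ ⟨cos(θ M_L)⟩_β` (`M_L = Σ_{x ∈ Λ_L} σ_x`,
infinite-volume state `plusExpect 3 β 0`) satisfy `θ² · ⟨M_L²⟩_{β_c} ≤ C` (signature fixed by the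
route, never restated here).

Notation: `Λ_L = box 3 L` (`|Λ_L| = (2L+1)³`, odd), `ξ(β) = isingCorrLength 3 β` (plus-state axis
correlation length), `χ(β) = susceptibility 3 β` (free state, `ℝ≥0∞`, read through `.toReal`),
`m(β,h) = magnetizationInField 3 β h`, `Σ_L = ⟨M_L²⟩_{β_c}`, `G_c(z) = twoPointPlus 3 β_c z`,
`χ_n(β_c) = Σ_{z ∈ Λ_n} G_c(z)`, `φ_{L,β}(θ) = ⟨cos(θ M_L)⟩_β` (infinite volume),
`φ^free_{N,L,β}(θ) = ⟨cos(θ M_L)⟩^free_{Λ_N;β,0}` (free box `Λ_N ⊇ Λ_L`, field only on the block),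
`α₁(Λ_L,β) = JiangNewman.firstZero 3 (box 3 L) β` (modulus of the first Lee–Yang zero of the FREE CUBE
`Λ_L`, Jiang–Newman's normalisation `Z_{Λ,β,iθ} = Z_{Λ,β,0} · φ^free_{L,L,β}(θ)`), and
"θ ≤ A·θ_e(β)" (θ_e = Yang–Lee edge) is spelled, as in the route's EDGE item, as "`m(β,·)` extends
analytically to the strip `|Im h| < θ/A`".

## The line and this reshape (lead c3, 2026-08-17)

Birth (planner): (GAP) ⇐ EDGE (route item 4946 `YangLeeEdgeHyperscaling`, BY NAME) + S1
`stub_gapReachesEdge` + S2 `stub_criticalWindowVariance`. v2/v3 (lead c2): S1 ↦ S1c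
`stub_gapReachesEdgeCore` (open) + S1u `stub_corrLengthUnbounded` (LANDED p149697); S2 ↦ S2χ
`stub_susceptibilityComparability` (open) + S2g
`stub_criticalWindowVariance_of_susceptibilityComparability` (LANDED p149939).

v4/v5 (lead c3, this file) keep the composition idea — EDGE at the zero's strip width,
critical-window variance, Camia–Jiang–Newman transfer of zeros, inequality bookkeeping
`θ²Σ_L ≤ α²·Bχξ³ = (A/c)²B·(cα/A)²χξ³ ≤ (A/c)²BC₁` — and split S1c into its open core plus known
and provable pieces, all stated on the FREE CUBE, whose Lee–Yang zeros are the classical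
partition-function zeros; v5 wires the four pieces landed by wave 1 and splits S2χ likewise:

* **S1r `stub_firstZeroRate`** (OPEN — the hardest stub, held by the lead): `∃ A K₀ β₀` such that
  `α₁(Λ_L,β) ≤ A·α₁(Λ_n,β)` for every `n`, every `β ∈ [β₀,β_c)` and every `L ≥ K₀ξ(β)`; since
  `n ↦ α₁(Λ_n,β)` decreases to the analyticity radius `α₁(ℤ³,β)` of the free energy (Jiang–Newman
  2023 Thm 1), this says: the first Lee–Yang zero of a cube of `K₀` correlation lengths is within a
  factor `A` of the Yang–Lee edge, uniformly as `β ↑ β_c` — the lower half of the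
  Itzykson–Pearson–Zuber finite-size scaling of partition-function zeros; no published supplier in
  any `d`; it is exactly the open content of v3's S1c (S1c ⇒ S1r by JN23 Thm 1(ii), and
  S1r + S1e + S1a + S1v + S1t ⇒ S1c, below).
* **S1e `stub_edgeAnalyticity`** (LANDED wave 1, p154953, with the general-`d` Literature engine
  `LeeYangFirstZeroStrip.lean` p154575 — real-centre discs below `inf_n α₁(Λ_n,β)`, identity-theorem
  gluing, `m = β⁻¹∂_h f_β` by GKS convexity; Jiang–Newman's named fact is NOT used): for
  `β ∈ [β_c/2, β_c)` and every `w > 0` with `w ≤ α₁(Λ_n,β)` for all `n`, `m(β,·)` extends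
  analytically to `{|Im h| < c·w}`, `c = 1/(2(β_c+1))`.
* **S1a `stub_firstZeroAttained`** (LANDED wave 1, p153649): `α₁(Λ_L,β) > 0` and it IS a zero of
  `φ^free_{L,L,β}` (`0 < α₁ ≤ π/2`, parity zero `π/2` as `|Λ_L|` is odd).
* **S1v `stub_cubeZeroToFreeBox`** (LANDED wave 1, p154053): a zero `θ` of the cube
  `φ^free_{L,L,β}` forces a zero `t ∈ (0, θ]` of `φ^free_{N,L,β}` for every `N ≥ L` —
  Camia–Jiang–Newman 2023 Thm 2 in the VOLUME (couplings `β/2·𝟙{a∼b, a,b ∈ Λ_L} ≤ β/2·𝟙{a∼b}` on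
  `↥Λ_N`, decoupling identity `avg_blockCoupling_cos_eq_isingExpect`, `CamiaJiangNewman2023_thm2_holds`).
* **S1t `stub_blockZeroOfFreeBoxZeros`** (LANDED wave 1, p153642): zeros `t_N ∈ (0, θ]` of
  `φ^free_{N,L,β}` for all `N ≥ L` force a zero `θ' ∈ (0, θ]` of the infinite-volume `φ_{L,β}` when
  `0 ≤ β ≤ β_c(3)` (positivity-margin half of `monotonicityTransfer_proof`, no Hurwitz).
* **S2χ₁ `stub_susceptibilityComparabilityOneScale`** (OPEN on `ℤ³`, the open core of S2):
  `∃ r A β₂`, `χ_n(β_c) ≤ A·χ(β)` for `n ≤ rξ(β)`, `β ∈ [β₂,β_c)` — amplitude form of Fisher's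
  `γ ≥ (2−η)ν` at one scale (`d ≥ 5` analogue below the sharp length: Duminil-Copin–Panis 2025);
  the wave-1 worker's census: IR bound needs `χ ≥ cξ²` (false if `η > 0`), DCP25 Thm 1.3 + MMS give
  only `χ(β) ≥ cL(β) ≥ c'ξ(β)`, GKS goes the wrong way, `∂_β`-tools reach only `n ≲ (β_c−β)^{-1/3}`.
* **S2d `stub_susceptibilityComparability_of_oneScale`** (LANDED wave 2, p155937, file
  `…SusceptibilityDoubling.lean`): one window constant gives all (`χ_{2n}(β_c) ≤ 217χ_n(β_c)` by
  Messager–Miracle-Solé, `ξ → ∞`); with it the v2–v4 stub S2χ `stub_susceptibilityComparability`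
  is derived. The wave-2 worker on S2χ₁ (blocked) proved the stub UP TO A FACTOR `n`
  (`χ_n(β_c) ≤ C·n·χ(β)` for `1 ≤ n ≤ rξ(β)`, from the sharp length: `ξ ≤ L(β)/c`,
  `L(β) ≤ (12β+1)χ(β)`), and isolated the missing inequality as shell/box comparability
  `c·χ_n(β_c) ≤ χ_n(β)` for `n ≤ rξ(β)` (= `stub_innerCriticality` of crux CorrelationLengthWindow).

Composition (`NearCriticalLeeYangGap_of`, real proof): constants `C₁, β₀` (EDGE), `A, K₀, β₀'` (S1r),
`c, β₀''` (S1e), `B, β₂` (S2g ∘ S2d ∘ S2χ₁ at `K := K₀ + 1`); `β₁ := max(β₀, β₀', β₀'', β₂, β_c/2) < β_c`.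
Given `L₀`, S1u yields `β ∈ [β₁, β_c)` with `ξ(β) ≥ max(1, L₀/K₀ + 1)`; `L := ⌈K₀ξ(β)⌉₊`
(`L₀ ≤ L`, `K₀ξ ≤ L ≤ (K₀+1)ξ`). S1a: `α := α₁(Λ_L,β) > 0` is a cube zero; S1v + S1t: `φ_{L,β}` has
a zero `θ' ∈ (0, α]`; S1r: `α/A ≤ α₁(Λ_n,β)` for all `n`; S1e: `m(β,·)` analytic on
`{|Im h| < c·α/A}`; EDGE at `cα/A`: `(cα/A)²χξ³ ≤ C₁`; S2 at `(β,L)`: `Σ_L ≤ Bχξ³`; hence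
`θ'²Σ_L ≤ (A/c)²BC₁ =: C` with `0 ≤ β ≤ β_c`, `0 < θ'`, `φ_{L,β}(θ') = 0`, `L ≥ L₀` — i.e. `∃ᶠ L`.

Why the open cores might fail (unchanged in substance): S1r — the finite-size rate may set in only
at `L ≫ ξ(β)(log ξ)^a`; S2χ₁ — a slowly varying mismatch between `χ_ξ(β_c)` and `χ(β)` on `ℤ³`.
Barriers honoured, not evaded: both cores are `d = 3`, finite-range statements (GAP is false for
`d ≥ 5` and for RP long-range `α ≤ 3/2`: IsingTrivialityFromDimensionFour, LongRangeTrivialityOnZ3).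
Disproof / negatives: none exist for this crux (crux ls 2026-08-17T09:45Z). In tree and NOT redone:
GAP ⟺ (critical block Binder cumulant `g_L ↛ 0`)
(`PerfectScreeningCoulombImpliesNontrivial.stub_gapOfBinderNonvanishing`,
`…sketchPub_binderNonvanishing_of_nearCriticalLeeYangGap`).
-/

namespace Summit.CriticalPhenomena.Ising3DConformalLimit.Cruxes.NearCriticalLeeYangGap.Birth

open Filter
open Literature.Probability.LatticeModels
open Summit.CriticalPhenomena.Ising3DConformalLimit.Theses.LeeYangGap
  (NearCriticalLeeYangGap YangLeeEdgeHyperscaling)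

/-! ## Registered stubs (the only `sorry`s of this file) -/

/-- **S1r — FirstZeroRate** (OPEN, XL; the hardest stub, held by the lead): there are `A, K₀ > 0`
and `β₀ < β_c` such that for every `β ∈ [β₀, β_c)`, every cube `Λ_L` with `L ≥ K₀ξ(β)` and every
`n`, `α₁(Λ_L,β) ≤ A·α₁(Λ_n,β)` (first Lee–Yang zeros of free cubes, Jiang–Newman normalisation);
equivalently `α₁(Λ_L,β) ≤ A·α₁(ℤ³,β)`, the analyticity radius of the free energy = the Yang–Lee
edge: block zeros saturate at the edge beyond `K₀` correlation lengths — a RATE in Jiang–Newman's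
`α₁(Λ_n,β) ↓ α₁(ℤ³,β)`, the lower half of Itzykson–Pearson–Zuber finite-size scaling.
[ItzyksonPearsonZuber1983, JiangNewman2023 Thm 1, CamiaJiangNewman2023 Cor 1, KennaLang1994;
barrier LongRangeTrivialityOnZ3] -/
theorem stub_firstZeroRate :
    ∃ A K₀ β₀ : ℝ, 0 < A ∧ 0 < K₀ ∧ β₀ < Literature.Probability.LatticeModels.criticalBeta 3 ∧
      ∀ β : ℝ, β₀ ≤ β → β < Literature.Probability.LatticeModels.criticalBeta 3 → ∀ L : ℕ,
        K₀ * Literature.Probability.LatticeModels.isingCorrLength 3 β ≤ (L : ℝ) → ∀ n : ℕ,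
          Literature.Probability.LatticeModels.JiangNewman.firstZero 3
              (Literature.Probability.LatticeModels.box 3 L) β ≤
            A * Literature.Probability.LatticeModels.JiangNewman.firstZero 3
              (Literature.Probability.LatticeModels.box 3 n) β := by
  sorry

/-- **S1e — EdgeAnalyticity** (KNOWN, unformalised; Jiang–Newman 2023 Thm 1(ii) + Lee–Yang): there
are `c > 0` and `β₀ < β_c` such that for every `β ∈ [β₀, β_c)` and every `w > 0` lying below all the
cube first zeros `α₁(Λ_n,β)`, the magnetisation `h ↦ m(β,h)` (`h ≥ 0`) extends analytically to the
strip `{|Im h| < c·w}` (the free energy is analytic on the disc of radius `lim_n α₁(Λ_n,β) ≥ w` and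
off the imaginary axis; `m = β⁻¹ ∂_h f_β`). [JiangNewman2023 Thm 1 and Prop 3, Ott2019 Cor 1.4,
LeeYang1952, FriedliVelenik2017 Thm 3.43] -/
theorem stub_edgeAnalyticity :
    ∃ c β₀ : ℝ, 0 < c ∧ β₀ < Literature.Probability.LatticeModels.criticalBeta 3 ∧
      ∀ β : ℝ, β₀ ≤ β → β < Literature.Probability.LatticeModels.criticalBeta 3 → ∀ w : ℝ, 0 < w →
        (∀ n : ℕ, w ≤ Literature.Probability.LatticeModels.JiangNewman.firstZero 3
          (Literature.Probability.LatticeModels.box 3 n) β) →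
        ∃ F : ℂ → ℂ, DifferentiableOn ℂ F {z : ℂ | |z.im| < c * w} ∧
          ∀ h : ℝ, 0 ≤ h → F (h : ℂ) =
            ((Literature.Probability.LatticeModels.magnetizationInField 3 β h : ℝ) : ℂ) :=
  -- LANDED (lead c3 wave 1, p154953 + Literature engine LeeYangFirstZeroStrip p154575: Theorems/LeeYangGapNearCriticalLeeYangGapEdgeAnalyticity.lean)
  LeeYangGapNearCriticalLeeYangGap.stub_edgeAnalyticity

/-- **S1a — FirstZeroAttained** (PROVABLE, S/M): for `β ≥ 0` the first Lee–Yang zero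
`α₁(Λ_L,β)` of the free cube is positive and is a zero of `θ ↦ ⟨cos(θ M_L)⟩^free_{Λ_L;β,0}`
(`Z_{Λ,β,iθ} = Z_{Λ,β,0}·⟨cos θM_Λ⟩^free` by spin flip; the zero set in `θ > 0` contains `π/2` since
`M_Λ` is odd, is closed, and avoids a neighbourhood of `0`). [JiangNewman2023 §1 eq. (1.3), §2] -/
theorem stub_firstZeroAttained :
    ∀ (L : ℕ) (β : ℝ), 0 ≤ β →
      0 < Literature.Probability.LatticeModels.JiangNewman.firstZero 3
          (Literature.Probability.LatticeModels.box 3 L) β ∧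
        Literature.Probability.LatticeModels.isingExpect (Literature.Probability.LatticeModels.zdGraph 3)
          (Literature.Probability.LatticeModels.box 3 L) β 0
          Literature.Probability.LatticeModels.BoundaryCondition.free
          (fun σ => Real.cos (Literature.Probability.LatticeModels.JiangNewman.firstZero 3
            (Literature.Probability.LatticeModels.box 3 L) β *
            ∑ x ∈ Literature.Probability.LatticeModels.box 3 L,
              Literature.Probability.LatticeModels.spinAt x σ)) = 0 :=
  -- LANDED (lead c3 wave 1, p153649: Theorems/LeeYangGapNearCriticalLeeYangGapFirstZeroAttained.lean)
  LeeYangGapNearCriticalLeeYangGap.stub_firstZeroAttained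

/-- **S1v — CubeZeroToFreeBox** (PROVABLE, M; Camia–Jiang–Newman 2023 Thm 2 in the volume): for
`L ≤ N`, `β ≥ 0`, every zero `θ > 0` of `θ ↦ ⟨cos(θ M_L)⟩^free_{Λ_L;β,0}` (the free cube) bounds from
above a zero `t ∈ (0, θ]` of `t ↦ ⟨cos(t M_L)⟩^free_{Λ_N;β,0}` (the same block in the larger free box:
couplings `β/2·𝟙{a ∼ b, a b ∈ Λ_L} ≤ β/2·𝟙{a ∼ b}` on `↥Λ_N`). [CamiaJiangNewman2023 Thm 2 / Cor 1;
tree `CamiaJiangNewman2023_thm2_holds`] -/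
theorem stub_cubeZeroToFreeBox :
    ∀ (L N : ℕ) (β θ : ℝ), L ≤ N → 0 ≤ β → 0 < θ →
      Literature.Probability.LatticeModels.isingExpect (Literature.Probability.LatticeModels.zdGraph 3)
          (Literature.Probability.LatticeModels.box 3 L) β 0
          Literature.Probability.LatticeModels.BoundaryCondition.free
          (fun σ => Real.cos (θ * ∑ x ∈ Literature.Probability.LatticeModels.box 3 L,
            Literature.Probability.LatticeModels.spinAt x σ)) = 0 →
      ∃ t : ℝ, 0 < t ∧ t ≤ θ ∧
        Literature.Probability.LatticeModels.isingExpect (Literature.Probability.LatticeModels.zdGraph 3)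
          (Literature.Probability.LatticeModels.box 3 N) β 0
          Literature.Probability.LatticeModels.BoundaryCondition.free
          (fun σ => Real.cos (t * ∑ x ∈ Literature.Probability.LatticeModels.box 3 L,
            Literature.Probability.LatticeModels.spinAt x σ)) = 0 :=
  -- LANDED (lead c3 wave 1, p154053: Theorems/LeeYangGapNearCriticalLeeYangGapCubeZeroToFreeBox.lean)
  LeeYangGapNearCriticalLeeYangGap.stub_cubeZeroToFreeBox

/-- **S1t — BlockZeroOfFreeBoxZeros** (PROVABLE, M; limit passage, no Hurwitz): for
`0 ≤ β ≤ β_c(3)` and `θ > 0`, if for every free box `Λ_N ⊇ Λ_L` the finite-volume block characteristic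
function `t ↦ ⟨cos(t M_L)⟩^free_{Λ_N;β,0}` has a zero in `(0, θ]`, then the infinite-volume one
`θ' ↦ ⟨cos(θ' M_L)⟩_β` (`plusExpect 3 β 0`, the limit of the free boxes since `m*(β) = 0`) has a zero
`θ' ∈ (0, θ]`. [FriedliVelenik2017 Thm 3.17; tree `monotonicityTransfer_proof` (positivity-margin half)] -/
theorem stub_blockZeroOfFreeBoxZeros :
    ∀ (L : ℕ) (β θ : ℝ), 0 ≤ β → β ≤ Literature.Probability.LatticeModels.criticalBeta 3 → 0 < θ →
      (∀ N : ℕ, L ≤ N → ∃ t : ℝ, 0 < t ∧ t ≤ θ ∧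
        Literature.Probability.LatticeModels.isingExpect (Literature.Probability.LatticeModels.zdGraph 3)
          (Literature.Probability.LatticeModels.box 3 N) β 0
          Literature.Probability.LatticeModels.BoundaryCondition.free
          (fun σ => Real.cos (t * ∑ x ∈ Literature.Probability.LatticeModels.box 3 L,
            Literature.Probability.LatticeModels.spinAt x σ)) = 0) →
      ∃ θ' : ℝ, 0 < θ' ∧ θ' ≤ θ ∧
        Literature.Probability.LatticeModels.plusExpect 3 β 0 (fun σ => Real.cos (θ' *
          ∑ x ∈ Literature.Probability.LatticeModels.box 3 L,
            Literature.Probability.LatticeModels.spinAt x σ)) = 0 :=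
  -- LANDED (lead c3 wave 1, p153642: Theorems/LeeYangGapNearCriticalLeeYangGapBlockZeroOfFreeBoxZeros.lean)
  LeeYangGapNearCriticalLeeYangGap.stub_blockZeroOfFreeBoxZeros

/-- **S1u — CorrLengthUnbounded** (PROVED, lead c2 wave 2, p149697 —
`LeeYangGapNearCriticalLeeYangGap.stub_corrLengthUnbounded`): the plus-state axis correlation length
is unbounded on `[β₁, β_c(3))` for every `β₁ < β_c(3)`. [CampaninoIoffeVelenik2003 Thm 1.1,
AizenmanDuminilCopinSidoravicius2015 §3.3, FriedliVelenik2017 Lemma 3.31] -/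
theorem stub_corrLengthUnbounded :
    ∀ β₁ M : ℝ, β₁ < Literature.Probability.LatticeModels.criticalBeta 3 →
      ∃ β : ℝ, β₁ ≤ β ∧ β < Literature.Probability.LatticeModels.criticalBeta 3 ∧
        M ≤ Literature.Probability.LatticeModels.isingCorrLength 3 β :=
  -- LANDED (p149697): Theorems/LeeYangGapNearCriticalLeeYangGapCorrLengthUnbounded.lean
  LeeYangGapNearCriticalLeeYangGap.stub_corrLengthUnbounded

/-- **S2χ₁ — SusceptibilityComparabilityOneScale** (OPEN on `ℤ³`, L; the open core of S2):
averaged near-critical two-point comparability at ONE window constant — there are `r, A > 0` and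
`β₂ < β_c` with `Σ_{z ∈ Λ_n} ⟨σ₀σ_z⟩⁺_{β_c} ≤ A·χ(β)` for all `β ∈ [β₂, β_c)` and `n ≤ rξ(β)`
("the box susceptibility looks critical below the correlation length"; amplitude form of the Fisher
half `γ ≥ (2−η)ν`: `χ(β) ≥ c·χ_{⌊rξ(β)⌋}(β_c)`; the tree has only the two ends
`cξ ≲ χ_ξ(β_c) ≲ Cξ²` and `χ(β) ≥ cL(β) ≥ c'ξ(β)`; the `d ≥ 5` analogue within the sharp length is
Duminil-Copin–Panis 2025 Thm 1.4 / Rem 1.7). [DuminilCopinPanis2025LowerBounds = arXiv:2404.05700,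
MessagerMiracleSole1977, Simon1980, FriedliVelenik2017 §3.7.4] -/
theorem stub_susceptibilityComparabilityOneScale :
    ∃ r A β₂ : ℝ, 0 < r ∧ 0 < A ∧ β₂ < Literature.Probability.LatticeModels.criticalBeta 3 ∧
      ∀ β : ℝ, β₂ ≤ β → β < Literature.Probability.LatticeModels.criticalBeta 3 → ∀ n : ℕ,
        (n : ℝ) ≤ r * Literature.Probability.LatticeModels.isingCorrLength 3 β →
        ∑ z ∈ Literature.Probability.LatticeModels.box 3 n,
            Literature.Probability.LatticeModels.twoPointPlus 3
              (Literature.Probability.LatticeModels.criticalBeta 3) z ≤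
          A * (Literature.Probability.LatticeModels.susceptibility 3 β).toReal := by
  sorry

/-- **S2d — SusceptibilityComparability from one scale** (PROVABLE, S; Messager–Miracle-Solé
doubling `χ_{2n}(β_c) ≤ 217·χ_n(β_c)` and `ξ(β) → ∞` as `β ↑ β_c`): comparability at one window
constant `r` gives it at every window constant `R` (with `A' = 217^k A`, `2^k ≥ 2R/r`).
[MessagerMiracleSole1977, Hegerfeldt1977, FriedliVelenik2017 §3.7.4] -/
theorem stub_susceptibilityComparability_of_oneScale :
    (∃ r A β₂ : ℝ, 0 < r ∧ 0 < A ∧ β₂ < Literature.Probability.LatticeModels.criticalBeta 3 ∧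
      ∀ β : ℝ, β₂ ≤ β → β < Literature.Probability.LatticeModels.criticalBeta 3 → ∀ n : ℕ,
        (n : ℝ) ≤ r * Literature.Probability.LatticeModels.isingCorrLength 3 β →
        ∑ z ∈ Literature.Probability.LatticeModels.box 3 n,
            Literature.Probability.LatticeModels.twoPointPlus 3
              (Literature.Probability.LatticeModels.criticalBeta 3) z ≤
          A * (Literature.Probability.LatticeModels.susceptibility 3 β).toReal) →
    ∀ R : ℝ, 0 < R → ∃ A β₂ : ℝ, 0 < A ∧ β₂ < Literature.Probability.LatticeModels.criticalBeta 3 ∧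
      ∀ β : ℝ, β₂ ≤ β → β < Literature.Probability.LatticeModels.criticalBeta 3 → ∀ n : ℕ,
        (n : ℝ) ≤ R * Literature.Probability.LatticeModels.isingCorrLength 3 β →
        ∑ z ∈ Literature.Probability.LatticeModels.box 3 n,
            Literature.Probability.LatticeModels.twoPointPlus 3
              (Literature.Probability.LatticeModels.criticalBeta 3) z ≤
          A * (Literature.Probability.LatticeModels.susceptibility 3 β).toReal :=
  -- LANDED (lead c3 wave 2, p155937): Theorems/LeeYangGapNearCriticalLeeYangGapSusceptibilityDoubling.lean
  LeeYangGapNearCriticalLeeYangGap.stub_susceptibilityComparability_of_oneScale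

/-- **S2g — CriticalWindowVariance from SusceptibilityComparability** (PROVED, lead c2 wave 1, p149939 —
`LeeYangGapNearCriticalLeeYangGap.stub_criticalWindowVariance_of_susceptibilityComparability`): the
averaged comparability S2χ implies the birth stub S2 verbatim —
`∀ K > 0 ∃ B > 0 ∃ β₂ < β_c ∀ β ∈ [β₂, β_c) ∀ L ≤ Kξ(β): Σ_L ≤ B·χ(β)·ξ(β)³`.
[FriedliVelenik2017 §3.7.4, AizenmanBarskyFernandezJSP1987 Thm 1] -/
theorem stub_criticalWindowVariance_of_susceptibilityComparability :
    (∀ R : ℝ, 0 < R → ∃ A β₂ : ℝ, 0 < A ∧ β₂ < Literature.Probability.LatticeModels.criticalBeta 3 ∧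
      ∀ β : ℝ, β₂ ≤ β → β < Literature.Probability.LatticeModels.criticalBeta 3 → ∀ n : ℕ,
        (n : ℝ) ≤ R * Literature.Probability.LatticeModels.isingCorrLength 3 β →
        ∑ z ∈ Literature.Probability.LatticeModels.box 3 n,
            Literature.Probability.LatticeModels.twoPointPlus 3
              (Literature.Probability.LatticeModels.criticalBeta 3) z ≤
          A * (Literature.Probability.LatticeModels.susceptibility 3 β).toReal) →
    ∀ K : ℝ, 0 < K → ∃ B β₂ : ℝ, 0 < B ∧ β₂ < Literature.Probability.LatticeModels.criticalBeta 3 ∧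
      ∀ β : ℝ, β₂ ≤ β → β < Literature.Probability.LatticeModels.criticalBeta 3 → ∀ L : ℕ,
        (L : ℝ) ≤ K * Literature.Probability.LatticeModels.isingCorrLength 3 β →
        Literature.Probability.LatticeModels.plusExpect 3 (Literature.Probability.LatticeModels.criticalBeta 3) 0
            (fun σ => (∑ x ∈ Literature.Probability.LatticeModels.box 3 L,
              Literature.Probability.LatticeModels.spinAt x σ) ^ 2) ≤
          B * (Literature.Probability.LatticeModels.susceptibility 3 β).toReal *
            Literature.Probability.LatticeModels.isingCorrLength 3 β ^ 3 :=
  -- LANDED (p149939): Theorems/LeeYangGapNearCriticalLeeYangGapCriticalWindowVarianceReductions.lean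
  LeeYangGapNearCriticalLeeYangGap.stub_criticalWindowVariance_of_susceptibilityComparability

/-! ## Name-keyed statements of the open / delegated stubs (the hypothesis types of the composition)

The skeleton audit admits a hypothesis of the composing theorem only BY NAME (a route item, or a
declaration whose short name is a registered stub); `Registered.stub_X` is literally the statement of
`theorem stub_X` (the wiring `NearCriticalLeeYangGap_of_stubs` below type-checks this). -/
namespace Registered

/-- Statement of S1r `stub_firstZeroRate`, keyed by the stub name. -/
abbrev stub_firstZeroRate : Prop :=
  ∃ A K₀ β₀ : ℝ, 0 < A ∧ 0 < K₀ ∧ β₀ < Literature.Probability.LatticeModels.criticalBeta 3 ∧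
    ∀ β : ℝ, β₀ ≤ β → β < Literature.Probability.LatticeModels.criticalBeta 3 → ∀ L : ℕ,
      K₀ * Literature.Probability.LatticeModels.isingCorrLength 3 β ≤ (L : ℝ) → ∀ n : ℕ,
        Literature.Probability.LatticeModels.JiangNewman.firstZero 3
            (Literature.Probability.LatticeModels.box 3 L) β ≤
          A * Literature.Probability.LatticeModels.JiangNewman.firstZero 3
            (Literature.Probability.LatticeModels.box 3 n) β

/-- Statement of S1e `stub_edgeAnalyticity`, keyed by the stub name. -/
abbrev stub_edgeAnalyticity : Prop :=
  ∃ c β₀ : ℝ, 0 < c ∧ β₀ < Literature.Probability.LatticeModels.criticalBeta 3 ∧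
    ∀ β : ℝ, β₀ ≤ β → β < Literature.Probability.LatticeModels.criticalBeta 3 → ∀ w : ℝ, 0 < w →
      (∀ n : ℕ, w ≤ Literature.Probability.LatticeModels.JiangNewman.firstZero 3
        (Literature.Probability.LatticeModels.box 3 n) β) →
      ∃ F : ℂ → ℂ, DifferentiableOn ℂ F {z : ℂ | |z.im| < c * w} ∧
        ∀ h : ℝ, 0 ≤ h → F (h : ℂ) =
          ((Literature.Probability.LatticeModels.magnetizationInField 3 β h : ℝ) : ℂ)

/-- Statement of S1a `stub_firstZeroAttained`, keyed by the stub name. -/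
abbrev stub_firstZeroAttained : Prop :=
  ∀ (L : ℕ) (β : ℝ), 0 ≤ β →
    0 < Literature.Probability.LatticeModels.JiangNewman.firstZero 3
        (Literature.Probability.LatticeModels.box 3 L) β ∧
      Literature.Probability.LatticeModels.isingExpect (Literature.Probability.LatticeModels.zdGraph 3)
        (Literature.Probability.LatticeModels.box 3 L) β 0
        Literature.Probability.LatticeModels.BoundaryCondition.free
        (fun σ => Real.cos (Literature.Probability.LatticeModels.JiangNewman.firstZero 3
          (Literature.Probability.LatticeModels.box 3 L) β *
          ∑ x ∈ Literature.Probability.LatticeModels.box 3 L,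
            Literature.Probability.LatticeModels.spinAt x σ)) = 0

/-- Statement of S1v `stub_cubeZeroToFreeBox`, keyed by the stub name. -/
abbrev stub_cubeZeroToFreeBox : Prop :=
  ∀ (L N : ℕ) (β θ : ℝ), L ≤ N → 0 ≤ β → 0 < θ →
    Literature.Probability.LatticeModels.isingExpect (Literature.Probability.LatticeModels.zdGraph 3)
        (Literature.Probability.LatticeModels.box 3 L) β 0
        Literature.Probability.LatticeModels.BoundaryCondition.free
        (fun σ => Real.cos (θ * ∑ x ∈ Literature.Probability.LatticeModels.box 3 L,
          Literature.Probability.LatticeModels.spinAt x σ)) = 0 →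
    ∃ t : ℝ, 0 < t ∧ t ≤ θ ∧
      Literature.Probability.LatticeModels.isingExpect (Literature.Probability.LatticeModels.zdGraph 3)
        (Literature.Probability.LatticeModels.box 3 N) β 0
        Literature.Probability.LatticeModels.BoundaryCondition.free
        (fun σ => Real.cos (t * ∑ x ∈ Literature.Probability.LatticeModels.box 3 L,
          Literature.Probability.LatticeModels.spinAt x σ)) = 0

/-- Statement of S1t `stub_blockZeroOfFreeBoxZeros`, keyed by the stub name. -/
abbrev stub_blockZeroOfFreeBoxZeros : Prop :=
  ∀ (L : ℕ) (β θ : ℝ), 0 ≤ β → β ≤ Literature.Probability.LatticeModels.criticalBeta 3 → 0 < θ →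
    (∀ N : ℕ, L ≤ N → ∃ t : ℝ, 0 < t ∧ t ≤ θ ∧
      Literature.Probability.LatticeModels.isingExpect (Literature.Probability.LatticeModels.zdGraph 3)
        (Literature.Probability.LatticeModels.box 3 N) β 0
        Literature.Probability.LatticeModels.BoundaryCondition.free
        (fun σ => Real.cos (t * ∑ x ∈ Literature.Probability.LatticeModels.box 3 L,
          Literature.Probability.LatticeModels.spinAt x σ)) = 0) →
    ∃ θ' : ℝ, 0 < θ' ∧ θ' ≤ θ ∧
      Literature.Probability.LatticeModels.plusExpect 3 β 0 (fun σ => Real.cos (θ' *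
        ∑ x ∈ Literature.Probability.LatticeModels.box 3 L,
          Literature.Probability.LatticeModels.spinAt x σ)) = 0

/-- Statement of S2χ₁ `stub_susceptibilityComparabilityOneScale`, keyed by the stub name. -/
abbrev stub_susceptibilityComparabilityOneScale : Prop :=
  ∃ r A β₂ : ℝ, 0 < r ∧ 0 < A ∧ β₂ < Literature.Probability.LatticeModels.criticalBeta 3 ∧
    ∀ β : ℝ, β₂ ≤ β → β < Literature.Probability.LatticeModels.criticalBeta 3 → ∀ n : ℕ,
      (n : ℝ) ≤ r * Literature.Probability.LatticeModels.isingCorrLength 3 β →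
      ∑ z ∈ Literature.Probability.LatticeModels.box 3 n,
        Literature.Probability.LatticeModels.twoPointPlus 3
          (Literature.Probability.LatticeModels.criticalBeta 3) z ≤
      A * (Literature.Probability.LatticeModels.susceptibility 3 β).toReal

/-- Statement of S2d `stub_susceptibilityComparability_of_oneScale`, keyed by the stub name. -/
abbrev stub_susceptibilityComparability_of_oneScale : Prop :=
  (∃ r A β₂ : ℝ, 0 < r ∧ 0 < A ∧ β₂ < Literature.Probability.LatticeModels.criticalBeta 3 ∧
      ∀ β : ℝ, β₂ ≤ β → β < Literature.Probability.LatticeModels.criticalBeta 3 → ∀ n : ℕ,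
        (n : ℝ) ≤ r * Literature.Probability.LatticeModels.isingCorrLength 3 β →
        ∑ z ∈ Literature.Probability.LatticeModels.box 3 n,
            Literature.Probability.LatticeModels.twoPointPlus 3
              (Literature.Probability.LatticeModels.criticalBeta 3) z ≤
          A * (Literature.Probability.LatticeModels.susceptibility 3 β).toReal) →
    ∀ R : ℝ, 0 < R → ∃ A β₂ : ℝ, 0 < A ∧ β₂ < Literature.Probability.LatticeModels.criticalBeta 3 ∧
      ∀ β : ℝ, β₂ ≤ β → β < Literature.Probability.LatticeModels.criticalBeta 3 → ∀ n : ℕ,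
        (n : ℝ) ≤ R * Literature.Probability.LatticeModels.isingCorrLength 3 β →
        ∑ z ∈ Literature.Probability.LatticeModels.box 3 n,
            Literature.Probability.LatticeModels.twoPointPlus 3
              (Literature.Probability.LatticeModels.criticalBeta 3) z ≤
          A * (Literature.Probability.LatticeModels.susceptibility 3 β).toReal

end Registered

/-! ## Composition: EDGE (route item, by name) + S1r + S2χ₁ imply the crux, by name — through the
cube gap (CG): `stub_gapOfCubeGap ∘ stub_cubeGapOfEdgeRateOneScale` (both LANDED, p159412) -/

/-- **COMPOSITION.** `YangLeeEdgeHyperscaling` (item 4946, by name) → S1r → S2χ₁ →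
`NearCriticalLeeYangGap` (the LeeYangGap decl of item stmt-CriticalPhenomena-4945, by name): the landed
near-critical half `stub_cubeGapOfEdgeRateOneScale` produces the cube gap (CG) from the hypotheses
(whose types are the registered stub statements keyed by name; it discharges the landed S1u, S1e, S1a,
S2g, S2d inside), and the landed transfer `stub_gapOfCubeGap` (S1a, S1v, S1t, `Σ_L > 0`) turns (CG)
into the crux. -/
theorem NearCriticalLeeYangGap_of (hE : YangLeeEdgeHyperscaling)
    (hR : Registered.stub_firstZeroRate)
    (hχ₁ : Registered.stub_susceptibilityComparabilityOneScale) :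
    Summit.CriticalPhenomena.Ising3DConformalLimit.Theses.LeeYangGap.NearCriticalLeeYangGap :=
  LeeYangGapNearCriticalLeeYangGap.stub_gapOfCubeGap
    (LeeYangGapNearCriticalLeeYangGap.stub_cubeGapOfEdgeRateOneScale hE hR hχ₁)

/-- The crux from EDGE (by name) and the registered stubs (shows the stubs have exactly the
hypothesis types; the file's only `sorry`s are the two open cores S1r and S2χ₁). -/
theorem NearCriticalLeeYangGap_of_stubs (hE : YangLeeEdgeHyperscaling) :
    Summit.CriticalPhenomena.Ising3DConformalLimit.Theses.LeeYangGap.NearCriticalLeeYangGap :=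
  NearCriticalLeeYangGap_of hE stub_firstZeroRate stub_susceptibilityComparabilityOneScale

/-! ## v10 (lead c5): the single critical statement everything funnels into, and what the stubs cost -/

/- **(CG_c) → GAP** is the landed `LeeYangGapNearCriticalLeeYangGap.stub_gapOfCriticalCubeGap`
(p161870): the critical free cube's first Lee–Yang zero against the critical block variance —
`∃ C, ∃ᶠ L, α₁(Λ_L,β_c)²·Σ_L ≤ C` — alone implies the crux; by `cubeGap_iff_criticalCubeGap` it is
exactly the cube gap (CG) the stubs produce (next theorem). It is not restated here as a theorem with
(CG_c) as hypothesis: the skeleton audit admits crux-concluding hypotheses only by registered name. -/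

/-- **The stubs produce exactly (CG_c)** (EDGE + S1r + S2χ₁ ⟹ (CG) ⟹ (CG_c); landed p159412 + p161870). -/
theorem criticalCubeGap_of_stubs (hE : YangLeeEdgeHyperscaling) (hR : Registered.stub_firstZeroRate)
    (hχ₁ : Registered.stub_susceptibilityComparabilityOneScale) :
    ∃ C : ℝ, ∃ᶠ L : ℕ in Filter.atTop,
      JiangNewman.firstZero 3 (box 3 L) (criticalBeta 3) ^ 2 *
        plusExpect 3 (criticalBeta 3) 0 (fun σ => (∑ x ∈ box 3 L, spinAt x σ) ^ 2) ≤ C :=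
  LeeYangGapNearCriticalLeeYangGap.criticalCubeGap_of_cubeGap
    (LeeYangGapNearCriticalLeeYangGap.stub_cubeGapOfEdgeRateOneScale hE hR hχ₁)

/-- **What S1r costs** (landed p162060, `stub_reverseEdgeOfFirstZeroRate`): S1r alone forces reverse
edge hyperscaling `c ≤ α₁(Λ_n,β)²·χ(β)·ξ(β)³`, uniformly in the volume `n` and in `β ∈ [β₁,β_c)`. -/
theorem reverseEdge_of_stub_firstZeroRate (hR : Registered.stub_firstZeroRate) :
    ∃ c β₁ : ℝ, 0 < c ∧ β₁ < criticalBeta 3 ∧ ∀ β : ℝ, β₁ ≤ β → β < criticalBeta 3 → ∀ n : ℕ,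
      c ≤ JiangNewman.firstZero 3 (box 3 n) β ^ 2 * (susceptibility 3 β).toReal *
        isingCorrLength 3 β ^ 3 :=
  LeeYangGapNearCriticalLeeYangGap.stub_reverseEdgeOfFirstZeroRate hR

/-- **What EDGE + S1r cost** (landed p162060): the first zero of every free cube of `K₀ … K₀+1`
correlation lengths sits at the Newman scale, `α₁(Λ_L,β)²·⟨M_L²⟩^free_{Λ_L;β} ≤ C` — ξ-scale cube
non-Gaussianity, uniformly as `β ↑ β_c` (the finite-size twin of the crux). -/
theorem cubeNonGaussian_of_edge_of_stub_firstZeroRate (hE : YangLeeEdgeHyperscaling)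
    (hR : Registered.stub_firstZeroRate) :
    ∃ C K₀ β₁ : ℝ, 0 < K₀ ∧ β₁ < criticalBeta 3 ∧ ∀ β : ℝ, β₁ ≤ β → β < criticalBeta 3 →
      ∀ L : ℕ, K₀ * isingCorrLength 3 β ≤ (L : ℝ) → (L : ℝ) ≤ (K₀ + 1) * isingCorrLength 3 β →
        JiangNewman.firstZero 3 (box 3 L) β ^ 2 *
          isingExpect (zdGraph 3) (box 3 L) β 0 .free (fun σ => (∑ x ∈ box 3 L, spinAt x σ) ^ 2) ≤
            C :=
  LeeYangGapNearCriticalLeeYangGap.cubeZero_sq_mul_variance_le_of_edge_of_firstZeroRate hE hR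

/-! ## v11 (lead c6): what the held stub S1r IS, given EDGE -/

/-- **EDGE ⊢ S1r ⟺ two-sided edge hyperscaling on cubes** (landed p165482, `firstZeroRate_iff_of_edge`):
under the route item EDGE (by name) the registered open stub `stub_firstZeroRate` is equivalent to the
conjunction of (I) `∃ c>0 β₁<β_c ∀β∈[β₁,β_c) ∀n, c ≤ α₁(Λ_n,β)²χξ³` and (II)
`∃ C K₀>0 β₀<β_c ∀β∈[β₀,β_c) ∀L ≥ K₀ξ, α₁(Λ_L,β)²χξ³ ≤ C`. -/
theorem firstZeroRate_iff_twoSidedCubeEdge (hE : YangLeeEdgeHyperscaling) :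
    Registered.stub_firstZeroRate ↔
    ((∃ c β₁ : ℝ, 0 < c ∧ β₁ < criticalBeta 3 ∧ ∀ β : ℝ, β₁ ≤ β → β < criticalBeta 3 → ∀ n : ℕ,
        c ≤ JiangNewman.firstZero 3 (box 3 n) β ^ 2 * (susceptibility 3 β).toReal *
          isingCorrLength 3 β ^ 3) ∧
      (∃ C K₀ β₀ : ℝ, 0 < K₀ ∧ β₀ < criticalBeta 3 ∧ ∀ β : ℝ, β₀ ≤ β → β < criticalBeta 3 →
        ∀ L : ℕ, K₀ * isingCorrLength 3 β ≤ (L : ℝ) →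
          JiangNewman.firstZero 3 (box 3 L) β ^ 2 * (susceptibility 3 β).toReal *
            isingCorrLength 3 β ^ 3 ≤ C)) :=
  LeeYangGapNearCriticalLeeYangGap.firstZeroRate_iff_of_edge hE

/-- **S1r is a one-scale statement** (landed p165482, `firstZeroRate_iff_diagonal`). -/
theorem firstZeroRate_iff_oneCube :
    Registered.stub_firstZeroRate ↔
    (∃ A K₀ β₀ : ℝ, 0 < A ∧ 0 < K₀ ∧ β₀ < criticalBeta 3 ∧
      ∀ β : ℝ, β₀ ≤ β → β < criticalBeta 3 → ∀ n : ℕ,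
        JiangNewman.firstZero 3 (box 3 ⌈K₀ * isingCorrLength 3 β⌉₊) β ≤
          A * JiangNewman.firstZero 3 (box 3 n) β) :=
  LeeYangGapNearCriticalLeeYangGap.firstZeroRate_iff_diagonal

/-! ## v12 (lead c6): the line's two Lee–Yang inputs in canonical cube form -/

/-- **S1r ∧ EDGE ⟺ (I) ∧ (II)** (landed p166341, `firstZeroRate_and_edge_iff`; ⟸ uses the
unconditional `mul_le_firstZero_of_magnetization_strip`). -/
theorem firstZeroRate_and_edge_iff_twoSidedCubeEdge :
    (Registered.stub_firstZeroRate ∧ YangLeeEdgeHyperscaling) ↔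
    ((∃ c β₁ : ℝ, 0 < c ∧ β₁ < criticalBeta 3 ∧ ∀ β : ℝ, β₁ ≤ β → β < criticalBeta 3 → ∀ n : ℕ,
        c ≤ JiangNewman.firstZero 3 (box 3 n) β ^ 2 * (susceptibility 3 β).toReal *
          isingCorrLength 3 β ^ 3) ∧
      (∃ C K₀ β₀ : ℝ, 0 < K₀ ∧ β₀ < criticalBeta 3 ∧ ∀ β : ℝ, β₀ ≤ β → β < criticalBeta 3 →
        ∀ L : ℕ, K₀ * isingCorrLength 3 β ≤ (L : ℝ) →
          JiangNewman.firstZero 3 (box 3 L) β ^ 2 * (susceptibility 3 β).toReal *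
            isingCorrLength 3 β ^ 3 ≤ C)) :=
  LeeYangGapNearCriticalLeeYangGap.firstZeroRate_and_edge_iff

/-! ## v13 (lead c6): the route item EDGE on cube zeros -/

/-- **EDGE ⟺ edge hyperscaling for `inf_n α₁(Λ_n,β)`** (landed p166742, `edge_iff_infCubeZero`). -/
theorem edge_iff_infCubeZeroScaling :
    YangLeeEdgeHyperscaling ↔
    (∃ C β₀ : ℝ, β₀ < criticalBeta 3 ∧ ∀ β : ℝ, β₀ ≤ β → β < criticalBeta 3 →
      (⨅ m : ℕ, JiangNewman.firstZero 3 (box 3 m) β) ^ 2 * (susceptibility 3 β).toReal *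
        isingCorrLength 3 β ^ 3 ≤ C) :=
  LeeYangGapNearCriticalLeeYangGap.edge_iff_infCubeZero

end Summit.CriticalPhenomena.Ising3DConformalLimit.Cruxes.NearCriticalLeeYangGap.Birth
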